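/-
Copyright (c) 2026 the pub-hodgecm-mathlib formalisation cell (harness21).  Prover seat hodgecm-mathlib-K2E3-p11 (g5), Track B «K2-LIT» ∕ h413
(`stmt-HodgeConjecture-24833`), line `K2_E3_EllipticInputs`, unit U12 §L, Richardson road for (LBGL-ge3) at `N = 3` (road owner K2E3-p11), brick (F-E) =
(LBGL-3E) «THE (2,1)-PARABOLIC SLICE DENSITY OF 𝔤𝔩₃(F)», FILE H″6b «THE LOCAL DENSITY AT EVERY REGULAR SEMISIMPLE POINT» (three cases by the number of
`F`-rational eigenvalues).  2026-09-04.
-/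
import Summits.HodgeConjecture.HodgeConjecture.Theorems.K2E3GL3ParabolicSliceLocalDensityTransport   -- ★ H″6a (this seat): `exists_open_local_density_conj`
import Summits.HodgeConjecture.HodgeConjecture.Theorems.K2E3GL3ParabolicSliceLocalDensityElliptic    -- ★ H″2 (this seat)
import Summits.HodgeConjecture.HodgeConjecture.Theorems.K2E3GL3ParabolicSliceLocalDensityDiagonal    -- ★ H″3b (this seat)
import Summits.HodgeConjecture.HodgeConjecture.Theorems.K2E3GL3SimpleEigenvalueLeviForm              -- ★ S″ p857803 (K2E3-p03 g4): Levi form at a simple rational eigenvalue, `charpoly_leviBlock`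
import Summits.HodgeConjecture.HodgeConjecture.Theorems.K2E3CubicRootDerivativeValuations             -- ★ R′ (K2E3-p03 g4): (E1) `eventually_map_normAbs_derivative_roots_charpoly_eq` (+ J0–J3, PART 1)
import Summits.HodgeConjecture.HodgeConjecture.Theorems.K2E3GL3OrbitChartDeriv                        -- ★ E1 (K2E3-p17 g6): `charpoly_conj_units`
import HarnessLib

/-!
# K2_E3 road (h413), §L ∕ Richardson road at `N = 3`, brick (F-E) FILE H″6b: the local density of the (2,1)-parabolic slice at every regular semisimple point

Cell `pub/hodgecm-mathlib` (D-0151), Track B, seat K2E3-p11 (g5) (road owner of (F-E) = (LBGL-3E) `sig_K2E3GL3ParabolicSliceDensity`; ROAD v2 on `K2/STATUS.md`,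
2026-09-04).  `--supports stmt-HodgeConjecture-24833 --as helper`; THEOREMS ONLY (no definition ∕ instance ∕ notation ∕ named fact ∕ `sorry`); never imports
`Cruxes/…/Lines`.  COUNT-NEUTRAL.

THE POINT.  `ρ(φ) = ∫⁻_K ∫⁻_{F⁷} φ(k·P(r)·k⁻¹) dr dκ`, `w(X) = C · Σ_{a ∈ roots_F(χ_X)} ‖χ_X'(a)‖_F⁻¹` (`C` the universal constant of the ball-piece formula ★ H″1, entering
as the hypothesis `hball`).  For every `X₀` with `disc χ_{X₀} ≠ 0` there is an open `V ∋ X₀` and a constant `e` with `ρ(1_V·h) = e·∫⁻_V h dμ𝔤` for all measurable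
`h ≥ 0` AND `w ≡ e` on `V`:
* `#roots_F = 0`: `V = {disc ≠ 0, no rational root}` (open, ★ R′ (J2)), `e = 0` — every `Ad(k)P(r)` has the rational eigenvalue `r₆`;
* `#roots_F = 1`: `X₀ = g·M(m)·g⁻¹` with `A` elliptic (★ S″), `e = C‖χ(m)‖⁻¹` (★ H″2 transported by ★ H″6a; `w` constant by ★ R′ (E1), `χ'_{X₀}(m₄) = χ(m)`);
* `#roots_F = 3`: `X₀ = g·diag(d)·g⁻¹` (★ J0), `e = C Σ_i ‖∏_{l≠i}(d_i − d_l)‖⁻¹` (★ H″3b transported; ★ R′ `derivative_eval_eq_of_roots_eq`).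
(`#roots_F = 2` is impossible for a cubic, ★ R′.)  §1 algebra of roots at the normal forms; §2 the three cases; **`exists_open_local_density`**.
[HarishChandra1999AdmissibleDistributions, §7 Lemma 7.8] [HarishChandra1970, Part V §4 Lemma 22]
HONEST LABEL: HC_CM is proved only modulo the 7 printed citations (2 remaining named inputs: hLiu418 = stmt-HodgeConjecture-24832, h413 = stmt-HodgeConjecture-24833)
until rung 0 closes; count-neutral helper ((LBGL-ge3)∕(LBGL-3E) NOT ★ here).

## References
* [HarishChandra1999AdmissibleDistributions] Harish-Chandra (DeBacker–Sally), *Admissible Invariant Distributions on Reductive p-adic Groups* (1999), §7, Lemma 7.8.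
* [HarishChandra1970] Harish-Chandra (van Dijk), *Harmonic Analysis on Reductive p-adic Groups*, LNM 162 (1970), Part V §4 Lemma 22.
-/

set_option autoImplicit false
set_option linter.dupNamespace false

noncomputable section

open MeasureTheory Measure Filter Topology Set Matrix Polynomial
open scoped MatrixGroups NNReal ENNReal
open Literature.NumberTheory.Automorphic Literature.NumberTheory.Automorphic.LocalFieldHaar
open Literature.NumberTheory.GaloisRepresentations Literature.NumberTheory.GaloisRepresentations.IsNonarchimedeanLocalField
open Summit.HodgeConjecture.HodgeConjecture.Cruxes.H413

namespace Summit.HodgeConjecture.HodgeConjecture.Cruxes.H413.K2E3GL3ParabolicSliceDensityLocal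

/-! ## §1  Roots at the normal forms -/

section Roots

variable {F : Type*} [Field F]

/-- `P(r) = [[r₀,r₁,r₂],[r₃,r₄,r₅],[0,0,r₆]]` has the rational eigenvalue `r₆`: `χ_{P(r)} = χ_{A'} · (X − C r₆)`. [folklore] -/
theorem isRoot_charpoly_parabolic (r : Fin 7 → F) :
    ((!![r 0, r 1, r 2; r 3, r 4, r 5; 0, 0, r 6] : Matrix (Fin 3) (Fin 3) F)).charpoly.IsRoot (r 6) := by
  rw [← Matrix.charpoly_transpose]
  have h := K2E3GL3SimpleEigenvalueLeviForm.charpoly_eq_of_col_two_eq_zero ((!![r 0, r 1, r 2; r 3, r 4, r 5; 0, 0, r 6] : Matrix (Fin 3) (Fin 3) F))ᵀ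
    (by simp) (by simp)
  rw [h, Polynomial.IsRoot, eval_mul]
  simp

/-- Hence `χ_{k·P(r)·k⁻¹}` has at least one `F`-rational root. [folklore] -/
theorem card_roots_charpoly_conj_parabolic_ne_zero (k : GL (Fin 3) F) (r : Fin 7 → F) :
    ((k : Matrix (Fin 3) (Fin 3) F) * !![r 0, r 1, r 2; r 3, r 4, r 5; 0, 0, r 6] * ((k⁻¹ : GL (Fin 3) F) : Matrix (Fin 3) (Fin 3) F)).charpoly.roots.card ≠ 0 := by
  rw [K2E3GL3OrbitChartDeriv.charpoly_conj_units]
  have hne : ((!![r 0, r 1, r 2; r 3, r 4, r 5; 0, 0, r 6] : Matrix (Fin 3) (Fin 3) F)).charpoly ≠ 0 := (Matrix.charpoly_monic _).ne_zero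
  have hmem : r 6 ∈ ((!![r 0, r 1, r 2; r 3, r 4, r 5; 0, 0, r 6] : Matrix (Fin 3) (Fin 3) F)).charpoly.roots :=
    (mem_roots hne).2 (isRoot_charpoly_parabolic r)
  exact (Multiset.card_pos_iff_exists_mem.2 ⟨_, hmem⟩).ne'

/-- `roots χ_{M(m)} = roots χ_A + {m₄}`. [folklore] -/
theorem roots_charpoly_leviBlock (m : Fin 5 → F) :
    ((!![m 0, m 1, 0; m 2, m 3, 0; 0, 0, m 4] : Matrix (Fin 3) (Fin 3) F)).charpoly.roots =
      ((!![m 0, m 1; m 2, m 3] : Matrix (Fin 2) (Fin 2) F)).charpoly.roots + {m 4} := by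
  rw [K2E3GL3SimpleEigenvalueLeviForm.charpoly_leviBlock, roots_mul, roots_X_sub_C]
  exact mul_ne_zero (Matrix.charpoly_monic _).ne_zero (X_sub_C_ne_zero _)

/-- If `χ_{M(m)}` has exactly one rational root, `χ_A` has none. [folklore] -/
theorem forall_eval_ne_zero_of_card_roots_leviBlock_eq_one (m : Fin 5 → F)
    (h1 : ((!![m 0, m 1, 0; m 2, m 3, 0; 0, 0, m 4] : Matrix (Fin 3) (Fin 3) F)).charpoly.roots.card = 1) :
    ∀ t : F, ((!![m 0, m 1; m 2, m 3] : Matrix (Fin 2) (Fin 2) F)).charpoly.eval t ≠ 0 := by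
  rw [roots_charpoly_leviBlock, Multiset.card_add, Multiset.card_singleton] at h1
  have h0 : ((!![m 0, m 1; m 2, m 3] : Matrix (Fin 2) (Fin 2) F)).charpoly.roots = 0 := Multiset.card_eq_zero.1 (by omega)
  intro t ht
  have hmem : t ∈ ((!![m 0, m 1; m 2, m 3] : Matrix (Fin 2) (Fin 2) F)).charpoly.roots := (mem_roots (Matrix.charpoly_monic _).ne_zero).2 ht
  rw [h0] at hmem
  exact Multiset.notMem_zero _ hmem

/-- The weight sum at `M(m)` with one rational root is the single term `‖χ(m)‖⁻¹`. [folklore] -/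
theorem sum_roots_leviBlock_of_card_eq_one [ValuativeRel F] [TopologicalSpace F] [IsNonarchimedeanLocalField F] (m : Fin 5 → F)
    (h1 : ((!![m 0, m 1, 0; m 2, m 3, 0; 0, 0, m 4] : Matrix (Fin 3) (Fin 3) F)).charpoly.roots.card = 1) :
    (((!![m 0, m 1, 0; m 2, m 3, 0; 0, 0, m 4] : Matrix (Fin 3) (Fin 3) F)).charpoly.roots.map fun a =>
        (((normAbs F (((!![m 0, m 1, 0; m 2, m 3, 0; 0, 0, m 4] : Matrix (Fin 3) (Fin 3) F)).charpoly.derivative.eval a))⁻¹ : ℝ≥0) : ℝ≥0∞)).sum =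
      (((normAbs F ((!![m 0, m 1; m 2, m 3] : Matrix (Fin 2) (Fin 2) F).charpoly.eval (m 4)))⁻¹ : ℝ≥0) : ℝ≥0∞) := by
  have hroots : ((!![m 0, m 1, 0; m 2, m 3, 0; 0, 0, m 4] : Matrix (Fin 3) (Fin 3) F)).charpoly.roots = {m 4} := by
    rw [roots_charpoly_leviBlock] at h1 ⊢
    rw [Multiset.card_add, Multiset.card_singleton] at h1
    have h0 : ((!![m 0, m 1; m 2, m 3] : Matrix (Fin 2) (Fin 2) F)).charpoly.roots = 0 := Multiset.card_eq_zero.1 (by omega)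
    rw [h0, zero_add]
  rw [hroots, Multiset.map_singleton, Multiset.sum_singleton, K2E3GL3SimpleEigenvalueLeviForm.derivative_charpoly_leviBlock_eval]

/-- `χ_{diag d} = (X − C d₀)(X − C d₁)(X − C d₂)`. [folklore] -/
theorem charpoly_diagonal_three (d : Fin 3 → F) :
    (Matrix.diagonal d).charpoly = (X - C (d 0)) * (X - C (d 1)) * (X - C (d 2)) := by
  rw [Matrix.charpoly, Matrix.det_fin_three]
  simp [Matrix.diagonal]

/-- `roots χ_{diag d} = {d₀, d₁, d₂}`. [folklore] -/
theorem roots_charpoly_diagonal_three (d : Fin 3 → F) : (Matrix.diagonal d).charpoly.roots = {d 0, d 1, d 2} := by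
  rw [charpoly_diagonal_three, roots_mul, roots_mul, roots_X_sub_C, roots_X_sub_C, roots_X_sub_C]
  · rfl
  · exact mul_ne_zero (X_sub_C_ne_zero _) (X_sub_C_ne_zero _)
  · exact mul_ne_zero (mul_ne_zero (X_sub_C_ne_zero _) (X_sub_C_ne_zero _)) (X_sub_C_ne_zero _)

/-- The weight sum at `diag d` (`d` injective): `Σ_i ‖(d_i − d_j)(d_i − d_k)‖⁻¹`, in the order of ★ H″3b. [folklore] -/
theorem sum_roots_diagonal [ValuativeRel F] [TopologicalSpace F] [IsNonarchimedeanLocalField F] (d : Fin 3 → F) :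
    ((Matrix.diagonal d).charpoly.roots.map fun a => (((normAbs F ((Matrix.diagonal d).charpoly.derivative.eval a))⁻¹ : ℝ≥0) : ℝ≥0∞)).sum =
      (((normAbs F ((d 0 - d 2) * (d 0 - d 1)))⁻¹ + (normAbs F ((d 1 - d 0) * (d 1 - d 2)))⁻¹ + (normAbs F ((d 2 - d 0) * (d 2 - d 1)))⁻¹ : ℝ≥0) : ℝ≥0∞) := by
  have hmon : (Matrix.diagonal d).charpoly.Monic := Matrix.charpoly_monic _
  have hdeg : (Matrix.diagonal d).charpoly.natDegree = 3 := by rw [Matrix.charpoly_natDegree_eq_dim, Fintype.card_fin]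
  have hr := roots_charpoly_diagonal_three d
  have hr1 : (Matrix.diagonal d).charpoly.roots = {d 1, d 0, d 2} := by rw [hr, Multiset.insert_eq_cons, Multiset.insert_eq_cons, Multiset.cons_swap]; rfl
  have hr2 : (Matrix.diagonal d).charpoly.roots = {d 2, d 0, d 1} := by
    rw [hr]
    show d 0 ::ₘ d 1 ::ₘ ({d 2} : Multiset F) = d 2 ::ₘ d 0 ::ₘ {d 1}
    rw [← Multiset.cons_zero (d 2), ← Multiset.cons_zero (d 1), Multiset.cons_swap (d 1) (d 2), Multiset.cons_swap (d 0) (d 2)]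
  have e0 := K2E3CubicRationalRootsLocallyConstant.derivative_eval_eq_of_roots_eq hmon hdeg hr
  have e1 := K2E3CubicRationalRootsLocallyConstant.derivative_eval_eq_of_roots_eq hmon hdeg hr1
  have e2 := K2E3CubicRationalRootsLocallyConstant.derivative_eval_eq_of_roots_eq hmon hdeg hr2
  rw [hr, Multiset.insert_eq_cons, Multiset.insert_eq_cons, Multiset.map_cons, Multiset.map_cons, Multiset.map_singleton, Multiset.sum_cons, Multiset.sum_cons,
    Multiset.sum_singleton, e0, e1, e2, mul_comm (d 0 - d 1) (d 0 - d 2)]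
  push_cast
  ring

end Roots

/-! ## §2  The three cases and the local density -/

section Local

variable {F : Type*} [Field F] [ValuativeRel F] [TopologicalSpace F] [IsNonarchimedeanLocalField F]
  [MeasurableSpace F] [BorelSpace F]
  [MeasurableSpace (Matrix (Fin 3) (Fin 3) F)] [BorelSpace (Matrix (Fin 3) (Fin 3) F)]
  [MeasurableSpace (GL (Fin 3) F)] [BorelSpace (GL (Fin 3) F)]

omit [MeasurableSpace F] [BorelSpace F] [MeasurableSpace (Matrix (Fin 3) (Fin 3) F)] [BorelSpace (Matrix (Fin 3) (Fin 3) F)]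
  [MeasurableSpace (GL (Fin 3) F)] [BorelSpace (GL (Fin 3) F)] in
/-- Near a point with `disc χ ≠ 0` the weight multiset `{‖χ_Y'(a)‖⁻¹ : a ∈ roots_F χ_Y}` is that of `X₀` (★ R′ (E1)) and `disc χ_Y ≠ 0`.
[cite: HarishChandra1999AdmissibleDistributions, §7] -/
theorem setOf_discr_ne_zero_and_sum_eq_mem_nhds (X₀ : Matrix (Fin 3) (Fin 3) F) (hD : X₀.charpoly.discr ≠ 0) :
    {Y : Matrix (Fin 3) (Fin 3) F | Y.charpoly.discr ≠ 0 ∧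
      (Y.charpoly.roots.map fun a => (((normAbs F (Y.charpoly.derivative.eval a))⁻¹ : ℝ≥0) : ℝ≥0∞)).sum =
        (X₀.charpoly.roots.map fun a => (((normAbs F (X₀.charpoly.derivative.eval a))⁻¹ : ℝ≥0) : ℝ≥0∞)).sum} ∈ 𝓝 X₀ := by
  haveI : T2Space F := (isLocalField F).toT2Space
  have h1 : ∀ᶠ Y in 𝓝 X₀, Y.charpoly.discr ≠ 0 :=
    (F0P3cStCharTSHCDGroupToLie.continuous_discr_charpoly (K := F)).continuousAt.eventually_ne hD
  have h2 := K2E3CubicRootDerivativeValuations.eventually_map_normAbs_derivative_roots_charpoly_eq X₀ hD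
  filter_upwards [h1, h2] with Y hY1 hY2
  refine ⟨hY1, ?_⟩
  have key : ∀ (p : F[X]), p.roots.map (fun a => (((normAbs F (p.derivative.eval a))⁻¹ : ℝ≥0) : ℝ≥0∞)) =
      (p.roots.map (fun a => normAbs F (p.derivative.eval a))).map (fun t : ℝ≥0 => ((t⁻¹ : ℝ≥0) : ℝ≥0∞)) := fun p => by
    rw [Multiset.map_map]; rfl
  rw [key, key, hY2]

omit [BorelSpace F] [BorelSpace (Matrix (Fin 3) (Fin 3) F)] [BorelSpace (GL (Fin 3) F)] in
/-- Case `#roots_F = 0`: near `X₀` both `ρ` and `w` vanish (every `Ad(k)P(r)` has the rational eigenvalue `r₆`).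
[cite: HarishChandra1999AdmissibleDistributions, §7 Lemma 7.8] -/
theorem exists_open_local_density_of_card_zero (κ : Measure ↥(glInt 3 F)) (dx : Measure F) (μ𝔤 : Measure (Matrix (Fin 3) (Fin 3) F)) (C : ℝ≥0∞)
    (X₀ : Matrix (Fin 3) (Fin 3) F) (hD : X₀.charpoly.discr ≠ 0) (h0 : X₀.charpoly.roots.card = 0) :
    ∃ V : Set (Matrix (Fin 3) (Fin 3) F), IsOpen V ∧ X₀ ∈ V ∧ ∃ e : ℝ≥0∞,
      (∀ h : Matrix (Fin 3) (Fin 3) F → ℝ≥0∞, Measurable h →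
        ∫⁻ k : ↥(glInt 3 F), ∫⁻ r : Fin 7 → F,
            V.indicator h (((k : GL (Fin 3) F) : Matrix (Fin 3) (Fin 3) F) * !![r 0, r 1, r 2; r 3, r 4, r 5; 0, 0, r 6] *
              ((((k : GL (Fin 3) F))⁻¹ : GL (Fin 3) F) : Matrix (Fin 3) (Fin 3) F)) ∂(Measure.pi fun _ : Fin 7 => dx) ∂κ =
          e * ∫⁻ X in V, h X ∂μ𝔤) ∧
      (∀ Y ∈ V, Y.charpoly.discr ≠ 0 ∧
        C * (Y.charpoly.roots.map fun a => (((normAbs F (Y.charpoly.derivative.eval a))⁻¹ : ℝ≥0) : ℝ≥0∞)).sum = e) := by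
  classical
  refine ⟨{Y | Y.charpoly.discr ≠ 0 ∧ Y.charpoly.roots.card = 0},
    K2E3CubicRationalRootsLocallyConstant.isOpen_setOf_charpoly_discr_ne_zero_and_card_roots_eq 0, ⟨hD, h0⟩, 0, fun h hh => ?_, fun Y hY => ⟨hY.1, ?_⟩⟩
  · rw [zero_mul]
    have hz : ∀ (k : ↥(glInt 3 F)) (r : Fin 7 → F),
        ({Y : Matrix (Fin 3) (Fin 3) F | Y.charpoly.discr ≠ 0 ∧ Y.charpoly.roots.card = 0}).indicator h
          (((k : GL (Fin 3) F) : Matrix (Fin 3) (Fin 3) F) * !![r 0, r 1, r 2; r 3, r 4, r 5; 0, 0, r 6] *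
            ((((k : GL (Fin 3) F))⁻¹ : GL (Fin 3) F) : Matrix (Fin 3) (Fin 3) F)) = 0 := fun k r =>
      Set.indicator_of_notMem (fun hmem => card_roots_charpoly_conj_parabolic_ne_zero (k : GL (Fin 3) F) r hmem.2) _
    simp only [hz, lintegral_zero]
  · rw [Multiset.card_eq_zero.1 hY.2, Multiset.map_zero, Multiset.sum_zero, mul_zero]

/-- Case `#roots_F = 1`: Levi form with elliptic `A` (★ S″), local density ★ H″2 transported by ★ H″6a. [cite: HarishChandra1999AdmissibleDistributions, §7 Lemma 7.8] -/
theorem exists_open_local_density_of_card_one (κ : Measure ↥(glInt 3 F)) [IsHaarMeasure κ] (dx : Measure F) [dx.IsAddHaarMeasure]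
    (μ𝔤 : Measure (Matrix (Fin 3) (Fin 3) F)) [μ𝔤.IsAddHaarMeasure] (C : ℝ≥0∞)
    (hball : ∀ m : Fin 5 → F, (!![m 0, m 1; m 2, m 3] : Matrix (Fin 2) (Fin 2) F).charpoly.eval (m 4) ≠ 0 →
      ∃ j₀ c₁ : ℕ, ∀ j' J : ℕ, j₀ ≤ j' → j' + c₁ ≤ J → ∀ h : Matrix (Fin 3) (Fin 3) F → ℝ≥0∞, Measurable h →
        ∫⁻ k in {k : ↥(glInt 3 F) | ((k : GL (Fin 3) F) : Matrix (Fin 3) (Fin 3) F) 2 0 ∈ primePowBall F j' ∧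
            ((k : GL (Fin 3) F) : Matrix (Fin 3) (Fin 3) F) 2 1 ∈ primePowBall F j'},
          ∫⁻ r : Fin 7 → F,
            ({X : Matrix (Fin 3) (Fin 3) F | ∀ i l, (X - !![m 0, m 1, 0; m 2, m 3, 0; 0, 0, m 4]) i l ∈ primePowBall F (J : ℤ)}).indicator h
              (((k : GL (Fin 3) F) : Matrix (Fin 3) (Fin 3) F) * !![r 0, r 1, r 2; r 3, r 4, r 5; 0, 0, r 6] *
                ((((k : GL (Fin 3) F))⁻¹ : GL (Fin 3) F) : Matrix (Fin 3) (Fin 3) F))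
            ∂(Measure.pi fun _ : Fin 7 => dx) ∂κ =
          C * ((normAbs F ((!![m 0, m 1; m 2, m 3] : Matrix (Fin 2) (Fin 2) F).charpoly.eval (m 4)))⁻¹ : ℝ≥0) *
            ∫⁻ X in {X : Matrix (Fin 3) (Fin 3) F | ∀ i l, (X - !![m 0, m 1, 0; m 2, m 3, 0; 0, 0, m 4]) i l ∈ primePowBall F (J : ℤ)}, h X ∂μ𝔤)
    (X₀ : Matrix (Fin 3) (Fin 3) F) (hD : X₀.charpoly.discr ≠ 0) (h1 : X₀.charpoly.roots.card = 1) :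
    ∃ V : Set (Matrix (Fin 3) (Fin 3) F), IsOpen V ∧ X₀ ∈ V ∧ ∃ e : ℝ≥0∞,
      (∀ h : Matrix (Fin 3) (Fin 3) F → ℝ≥0∞, Measurable h →
        ∫⁻ k : ↥(glInt 3 F), ∫⁻ r : Fin 7 → F,
            V.indicator h (((k : GL (Fin 3) F) : Matrix (Fin 3) (Fin 3) F) * !![r 0, r 1, r 2; r 3, r 4, r 5; 0, 0, r 6] *
              ((((k : GL (Fin 3) F))⁻¹ : GL (Fin 3) F) : Matrix (Fin 3) (Fin 3) F)) ∂(Measure.pi fun _ : Fin 7 => dx) ∂κ =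
          e * ∫⁻ X in V, h X ∂μ𝔤) ∧
      (∀ Y ∈ V, Y.charpoly.discr ≠ 0 ∧
        C * (Y.charpoly.roots.map fun a => (((normAbs F (Y.charpoly.derivative.eval a))⁻¹ : ℝ≥0) : ℝ≥0∞)).sum = e) := by
  classical
  haveI : T2Space F := (isLocalField F).toT2Space
  have hmon : X₀.charpoly.Monic := Matrix.charpoly_monic X₀
  have hdeg : X₀.charpoly.natDegree = 3 := by rw [Matrix.charpoly_natDegree_eq_dim, Fintype.card_fin]
  have hχ0 : X₀.charpoly ≠ 0 := hmon.ne_zero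
  have hN := setOf_discr_ne_zero_and_sum_eq_mem_nhds X₀ hD
  obtain ⟨a, ha⟩ := Multiset.card_eq_one.1 h1
  have haroot : X₀.charpoly.IsRoot a := (mem_roots hχ0).1 (by rw [ha]; exact Multiset.mem_singleton_self a)
  have hsep : X₀.charpoly.Separable := K2E3CharpolyRootsPerturbation.separable_of_discr_ne_zero hmon (by omega) hD
  have ha' : X₀.charpoly.derivative.eval a ≠ 0 := hsep.eval₂_derivative_ne_zero (RingHom.id F) haroot
  obtain ⟨g, m, -, hX⟩ := K2E3GL3SimpleEigenvalueLeviForm.exists_conj_leviBlock_of_isRoot_of_derivative_ne_zero X₀ a haroot ha'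
  have hcp : ((!![m 0, m 1, 0; m 2, m 3, 0; 0, 0, m 4] : Matrix (Fin 3) (Fin 3) F)).charpoly = X₀.charpoly := by
    rw [hX, K2E3GL3OrbitChartDeriv.charpoly_conj_units]
  have h1' : ((!![m 0, m 1, 0; m 2, m 3, 0; 0, 0, m 4] : Matrix (Fin 3) (Fin 3) F)).charpoly.roots.card = 1 := by rw [hcp]; exact h1
  have hA := forall_eval_ne_zero_of_card_roots_leviBlock_eq_one m h1'
  obtain ⟨J₀, hloc⟩ := K2E3GL3ParabolicSliceLocalDensityElliptic.lintegral_parabolicSlice_ball_indicator_eq_of_forall_eval_ne_zero κ dx μ𝔤 C hball m hA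
  have hN' : {Y : Matrix (Fin 3) (Fin 3) F | Y.charpoly.discr ≠ 0 ∧
      (Y.charpoly.roots.map fun a => (((normAbs F (Y.charpoly.derivative.eval a))⁻¹ : ℝ≥0) : ℝ≥0∞)).sum =
        (X₀.charpoly.roots.map fun a => (((normAbs F (X₀.charpoly.derivative.eval a))⁻¹ : ℝ≥0) : ℝ≥0∞)).sum} ∈
      𝓝 ((g : Matrix (Fin 3) (Fin 3) F) * !![m 0, m 1, 0; m 2, m 3, 0; 0, 0, m 4] * ((g⁻¹ : GL (Fin 3) F) : Matrix (Fin 3) (Fin 3) F)) := by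
    rw [← hX]; exact hN
  obtain ⟨V, hVo, hXV, hVN, hV⟩ := K2E3GL3ParabolicSliceLocalDensityTransport.exists_open_local_density_conj κ dx μ𝔤 _ _ J₀ hloc g hN'
  refine ⟨V, hVo, by rw [hX]; exact hXV, _, hV, fun Y hY => ⟨(hVN hY).1, ?_⟩⟩
  rw [(hVN hY).2, ← hcp, sum_roots_leviBlock_of_card_eq_one m h1']

/-- Case `#roots_F = 3`: diagonal form (★ J0), local density ★ H″3b transported by ★ H″6a. [cite: HarishChandra1999AdmissibleDistributions, §7 Lemma 7.8] -/
theorem exists_open_local_density_of_card_three (κ : Measure ↥(glInt 3 F)) [IsHaarMeasure κ] (dx : Measure F) [dx.IsAddHaarMeasure]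
    (μ𝔤 : Measure (Matrix (Fin 3) (Fin 3) F)) [μ𝔤.IsAddHaarMeasure] (C : ℝ≥0∞)
    (hball : ∀ m : Fin 5 → F, (!![m 0, m 1; m 2, m 3] : Matrix (Fin 2) (Fin 2) F).charpoly.eval (m 4) ≠ 0 →
      ∃ j₀ c₁ : ℕ, ∀ j' J : ℕ, j₀ ≤ j' → j' + c₁ ≤ J → ∀ h : Matrix (Fin 3) (Fin 3) F → ℝ≥0∞, Measurable h →
        ∫⁻ k in {k : ↥(glInt 3 F) | ((k : GL (Fin 3) F) : Matrix (Fin 3) (Fin 3) F) 2 0 ∈ primePowBall F j' ∧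
            ((k : GL (Fin 3) F) : Matrix (Fin 3) (Fin 3) F) 2 1 ∈ primePowBall F j'},
          ∫⁻ r : Fin 7 → F,
            ({X : Matrix (Fin 3) (Fin 3) F | ∀ i l, (X - !![m 0, m 1, 0; m 2, m 3, 0; 0, 0, m 4]) i l ∈ primePowBall F (J : ℤ)}).indicator h
              (((k : GL (Fin 3) F) : Matrix (Fin 3) (Fin 3) F) * !![r 0, r 1, r 2; r 3, r 4, r 5; 0, 0, r 6] *
                ((((k : GL (Fin 3) F))⁻¹ : GL (Fin 3) F) : Matrix (Fin 3) (Fin 3) F))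
            ∂(Measure.pi fun _ : Fin 7 => dx) ∂κ =
          C * ((normAbs F ((!![m 0, m 1; m 2, m 3] : Matrix (Fin 2) (Fin 2) F).charpoly.eval (m 4)))⁻¹ : ℝ≥0) *
            ∫⁻ X in {X : Matrix (Fin 3) (Fin 3) F | ∀ i l, (X - !![m 0, m 1, 0; m 2, m 3, 0; 0, 0, m 4]) i l ∈ primePowBall F (J : ℤ)}, h X ∂μ𝔤)
    (X₀ : Matrix (Fin 3) (Fin 3) F) (hD : X₀.charpoly.discr ≠ 0) (h3 : X₀.charpoly.roots.card = 3) :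
    ∃ V : Set (Matrix (Fin 3) (Fin 3) F), IsOpen V ∧ X₀ ∈ V ∧ ∃ e : ℝ≥0∞,
      (∀ h : Matrix (Fin 3) (Fin 3) F → ℝ≥0∞, Measurable h →
        ∫⁻ k : ↥(glInt 3 F), ∫⁻ r : Fin 7 → F,
            V.indicator h (((k : GL (Fin 3) F) : Matrix (Fin 3) (Fin 3) F) * !![r 0, r 1, r 2; r 3, r 4, r 5; 0, 0, r 6] *
              ((((k : GL (Fin 3) F))⁻¹ : GL (Fin 3) F) : Matrix (Fin 3) (Fin 3) F)) ∂(Measure.pi fun _ : Fin 7 => dx) ∂κ =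
          e * ∫⁻ X in V, h X ∂μ𝔤) ∧
      (∀ Y ∈ V, Y.charpoly.discr ≠ 0 ∧
        C * (Y.charpoly.roots.map fun a => (((normAbs F (Y.charpoly.derivative.eval a))⁻¹ : ℝ≥0) : ℝ≥0∞)).sum = e) := by
  classical
  haveI : T2Space F := (isLocalField F).toT2Space
  have hN := setOf_discr_ne_zero_and_sum_eq_mem_nhds X₀ hD
  obtain ⟨g, d, hd, hX⟩ := K2E3CubicRationalRootsLocallyConstant.exists_conj_diagonal_of_card_roots_eq_three X₀ h3 hD
  obtain ⟨J₀, hloc⟩ := K2E3GL3ParabolicSliceLocalDensityDiagonal.lintegral_parabolicSlice_ball_indicator_eq_diagonal κ dx μ𝔤 C hball d hd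
  have hcp : (Matrix.diagonal d).charpoly = X₀.charpoly := by rw [hX, K2E3GL3OrbitChartDeriv.charpoly_conj_units]
  have hN' : {Y : Matrix (Fin 3) (Fin 3) F | Y.charpoly.discr ≠ 0 ∧
      (Y.charpoly.roots.map fun a => (((normAbs F (Y.charpoly.derivative.eval a))⁻¹ : ℝ≥0) : ℝ≥0∞)).sum =
        (X₀.charpoly.roots.map fun a => (((normAbs F (X₀.charpoly.derivative.eval a))⁻¹ : ℝ≥0) : ℝ≥0∞)).sum} ∈
      𝓝 ((g : Matrix (Fin 3) (Fin 3) F) * Matrix.diagonal d * ((g⁻¹ : GL (Fin 3) F) : Matrix (Fin 3) (Fin 3) F)) := by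
    rw [← hX]; exact hN
  obtain ⟨V, hVo, hXV, hVN, hV⟩ := K2E3GL3ParabolicSliceLocalDensityTransport.exists_open_local_density_conj κ dx μ𝔤 _ _ J₀ hloc g hN'
  refine ⟨V, hVo, by rw [hX]; exact hXV, _, hV, fun Y hY => ⟨(hVN hY).1, ?_⟩⟩
  rw [(hVN hY).2, ← hcp, sum_roots_diagonal d]

/-- **THE LOCAL DENSITY AT EVERY REGULAR SEMISIMPLE POINT.**  `κ` a Haar measure on `K = GL₃(𝒪)`, `dx`, `μ𝔤` additive Haar measures, `C` a constant with the ball-piece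
formula `hball` (★ H″1).  For every `X₀` with `disc χ_{X₀} ≠ 0` there are an open `V ∋ X₀` and `e ∈ [0, ∞]` with `ρ(1_V·h) = e · ∫⁻_V h dμ𝔤` for all measurable `h ≥ 0`
and `C · Σ_{a ∈ roots_F χ_Y} ‖χ_Y'(a)‖⁻¹ = e` on `V` (cases `#roots_F ∈ {0, 1, 3}`; `2` is impossible for a cubic, ★ R′).
[cite: HarishChandra1999AdmissibleDistributions, §7 Lemma 7.8] [cite: HarishChandra1970, Part V §4 Lemma 22] -/
theorem exists_open_local_density (κ : Measure ↥(glInt 3 F)) [IsHaarMeasure κ] (dx : Measure F) [dx.IsAddHaarMeasure]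
    (μ𝔤 : Measure (Matrix (Fin 3) (Fin 3) F)) [μ𝔤.IsAddHaarMeasure] (C : ℝ≥0∞)
    (hball : ∀ m : Fin 5 → F, (!![m 0, m 1; m 2, m 3] : Matrix (Fin 2) (Fin 2) F).charpoly.eval (m 4) ≠ 0 →
      ∃ j₀ c₁ : ℕ, ∀ j' J : ℕ, j₀ ≤ j' → j' + c₁ ≤ J → ∀ h : Matrix (Fin 3) (Fin 3) F → ℝ≥0∞, Measurable h →
        ∫⁻ k in {k : ↥(glInt 3 F) | ((k : GL (Fin 3) F) : Matrix (Fin 3) (Fin 3) F) 2 0 ∈ primePowBall F j' ∧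
            ((k : GL (Fin 3) F) : Matrix (Fin 3) (Fin 3) F) 2 1 ∈ primePowBall F j'},
          ∫⁻ r : Fin 7 → F,
            ({X : Matrix (Fin 3) (Fin 3) F | ∀ i l, (X - !![m 0, m 1, 0; m 2, m 3, 0; 0, 0, m 4]) i l ∈ primePowBall F (J : ℤ)}).indicator h
              (((k : GL (Fin 3) F) : Matrix (Fin 3) (Fin 3) F) * !![r 0, r 1, r 2; r 3, r 4, r 5; 0, 0, r 6] *
                ((((k : GL (Fin 3) F))⁻¹ : GL (Fin 3) F) : Matrix (Fin 3) (Fin 3) F))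
            ∂(Measure.pi fun _ : Fin 7 => dx) ∂κ =
          C * ((normAbs F ((!![m 0, m 1; m 2, m 3] : Matrix (Fin 2) (Fin 2) F).charpoly.eval (m 4)))⁻¹ : ℝ≥0) *
            ∫⁻ X in {X : Matrix (Fin 3) (Fin 3) F | ∀ i l, (X - !![m 0, m 1, 0; m 2, m 3, 0; 0, 0, m 4]) i l ∈ primePowBall F (J : ℤ)}, h X ∂μ𝔤)
    (X₀ : Matrix (Fin 3) (Fin 3) F) (hD : X₀.charpoly.discr ≠ 0) :
    ∃ V : Set (Matrix (Fin 3) (Fin 3) F), IsOpen V ∧ X₀ ∈ V ∧ ∃ e : ℝ≥0∞,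
      (∀ h : Matrix (Fin 3) (Fin 3) F → ℝ≥0∞, Measurable h →
        ∫⁻ k : ↥(glInt 3 F), ∫⁻ r : Fin 7 → F,
            V.indicator h (((k : GL (Fin 3) F) : Matrix (Fin 3) (Fin 3) F) * !![r 0, r 1, r 2; r 3, r 4, r 5; 0, 0, r 6] *
              ((((k : GL (Fin 3) F))⁻¹ : GL (Fin 3) F) : Matrix (Fin 3) (Fin 3) F)) ∂(Measure.pi fun _ : Fin 7 => dx) ∂κ =
          e * ∫⁻ X in V, h X ∂μ𝔤) ∧
      (∀ Y ∈ V, Y.charpoly.discr ≠ 0 ∧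
        C * (Y.charpoly.roots.map fun a => (((normAbs F (Y.charpoly.derivative.eval a))⁻¹ : ℝ≥0) : ℝ≥0∞)).sum = e) := by
  have hdeg : X₀.charpoly.natDegree = 3 := by rw [Matrix.charpoly_natDegree_eq_dim, Fintype.card_fin]
  have hne2 : X₀.charpoly.roots.card ≠ 2 := K2E3CharpolyRootsPerturbation.card_roots_ne_two_of_natDegree_eq_three hdeg
  have hle3 : X₀.charpoly.roots.card ≤ 3 := by
    have h := Polynomial.card_roots' X₀.charpoly
    rwa [hdeg] at h
  rcases Nat.eq_zero_or_pos X₀.charpoly.roots.card with h0 | hpos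
  · exact exists_open_local_density_of_card_zero κ dx μ𝔤 C X₀ hD h0
  · by_cases h1 : X₀.charpoly.roots.card = 1
    · exact exists_open_local_density_of_card_one κ dx μ𝔤 C hball X₀ hD h1
    · have h3 : X₀.charpoly.roots.card = 3 := by omega
      exact exists_open_local_density_of_card_three κ dx μ𝔤 C hball X₀ hD h3

end Local

end Summit.HodgeConjecture.HodgeConjecture.Cruxes.H413.K2E3GL3ParabolicSliceDensityLocal

end
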